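import Summits.AtomisticToContinuum.Crystallization.Theorems.ChargedEnergyGapChartDialZD
import Summits.AtomisticToContinuum.Crystallization.Theorems.ChargedEnergyGapChartDialZE
import Literature.Geometry.DiscreteGeometry.AntiprismAngleBudget

/-!
# `ChargedEnergyGap` · the CHART DIAL, part ZF: NO SCALE-FREE DOZEN IS A HEXAGONAL ANTIPRISM — piece [A]
(decomp-a2c lens-3 g39 node «ChargeFreeGap»; closes `NoAntiprismDozen` of part Q)

`noAntiprismDozen_holds : NoAntiprismDozen`.  The tree's antiprism angle budget
`Literature.Geometry.DiscreteGeometry.AntiprismShell.no_config` (two unit hexagons `A, B : Fin 6 → ℝ³` with the bond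
windows of the antiprism, far second ring-neighbours, the `36` band corners in `[arccos (81/200), arccos (1/4)]` and
`(A₀, A₁, B₀)` positively oriented do not exist) is instantiated on the normalised code of a scale-free dozen whose bond
graph is the labelled antiprism (`AntiprismIso b σ`): `A i := û (σ i)`, `B i := û (σ (6 + i))`.
* unit vectors, bond windows `[2201/4802, 2801/5202]`: part W (`norm_normalize`, `le_inner_normalize`,
  `inner_normalize_le`); the antiprism's edge list `apList` is decoded by `decide`;
* far pairs `⟪A_{i+2}, A_i⟫, ⟪B_{i+2}, B_i⟫ ≤ 1233/5202`: part ZD (`inner_le_far_of_chain`) along the bond chains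
  `A_{i+2} – B_{i+1} – B_i – A_i` about `A_{i+1}` and `B_{i+2} – A_{i+2} – A_{i+1} – B_i` about `B_{i+1}`;
* corner window: part ZE (`IsScaleFreeDozen.tCorner_window`) transported to the normalised code by
  `AntiprismShell.angle_perpTo_nrm`;
* orientation: if `orient3 (A₀, A₁, B₀) < 0` pass to the mirror image `−t` (again a scale-free dozen with the same
  bonds; `orient3_neg_neg_neg`), and `orient3 = 0` is excluded by `orient3_ne_zero_of_angle` (the corner at `A₀` is a
  genuine turn) — exactly as in the gapped `stub_noAntiprism`.

After this part, hypothesis 3 of record (`ChargeFreeShaped (3/20)`) rests on the two metric pieces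
[C] `GraphedDozenClose (3/20) fccTuple`, [C] `GraphedDozenClose (3/20) hcpTuple` only (parts ZC + ZF).

No `sorry`, no new axiom, no instance / notation / option.  New definitions: the two label maps `apA`, `apB`.
-/

noncomputable section

open scoped RealInnerProductSpace
open Literature.MathematicalPhysics.StatisticalMechanics
open Literature.Geometry.DiscreteGeometry
open Literature.Geometry.DiscreteGeometry.ShellCensus
open Summit.AtomisticToContinuum.Crystallization.Theses.PricedLinkCensus
open Summit.AtomisticToContinuum.Crystallization.Theorems.ChargedEnergyGapNegative

namespace Summit.AtomisticToContinuum.Crystallization.Theorems.ChargedEnergyGapChartDial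

/-! ## §1 The labels of the two hexagons and the edge list, decoded -/

/-- Ring `A` of the labelled antiprism: labels `0, …, 5`. -/
def apA (i : Fin 6) : Fin 12 := ⟨i.val, lt_of_lt_of_le i.isLt (by norm_num)⟩

/-- Ring `B` of the labelled antiprism: labels `6, …, 11`. -/
def apB (i : Fin 6) : Fin 12 := ⟨i.val + 6, by have := i.isLt; omega⟩

/-- Ring `A` edges `{i, i+1}` are in `apList`. -/
theorem apA_ring : ∀ i j : Fin 6, j = i + 1 →
    apA i ≠ apA j ∧ (min (apA i).val (apA j).val, max (apA i).val (apA j).val) ∈ apList := by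
  decide

/-- Ring `B` edges `{6+i, 6+i+1}` are in `apList`. -/
theorem apB_ring : ∀ i j : Fin 6, j = i + 1 →
    apB i ≠ apB j ∧ (min (apB i).val (apB j).val, max (apB i).val (apB j).val) ∈ apList := by
  decide

/-- Zigzag edges `{i, 6+i}` are in `apList`. -/
theorem apAB_rung : ∀ i : Fin 6,
    apA i ≠ apB i ∧ (min (apA i).val (apB i).val, max (apA i).val (apB i).val) ∈ apList := by
  decide

/-- Zigzag edges `{i+1, 6+i}` are in `apList`. -/
theorem apAB_diag : ∀ i j : Fin 6, j = i + 1 →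
    apA j ≠ apB i ∧ (min (apA j).val (apB i).val, max (apA j).val (apB i).val) ∈ apList := by
  decide

/-- The two rings are disjoint. -/
theorem apA_ne_apB : ∀ i j : Fin 6, apA i ≠ apB j := by
  decide

namespace AntiprismIso

variable {b : Fin 12 → Fin 12 → Prop} {σ : Equiv.Perm (Fin 12)}

/-- A labelled edge is a bond. -/
theorem bond (hI : AntiprismIso b σ) {v w : Fin 12} (hne : v ≠ w)
    (hmem : (min v.val w.val, max v.val w.val) ∈ apList) : b (σ v) (σ w) :=
  (hI v w hne).2 hmem

/-- Ring `A` bonds. -/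
theorem bAA (hI : AntiprismIso b σ) (i j : Fin 6) (h : j = i + 1) : b (σ (apA i)) (σ (apA j)) :=
  hI.bond (apA_ring i j h).1 (apA_ring i j h).2

/-- Ring `B` bonds. -/
theorem bBB (hI : AntiprismIso b σ) (i j : Fin 6) (h : j = i + 1) : b (σ (apB i)) (σ (apB j)) :=
  hI.bond (apB_ring i j h).1 (apB_ring i j h).2

/-- Rung bonds `A_i B_i`. -/
theorem bAB (hI : AntiprismIso b σ) (i : Fin 6) : b (σ (apA i)) (σ (apB i)) :=
  hI.bond (apAB_rung i).1 (apAB_rung i).2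

/-- Diagonal bonds `A_{i+1} B_i`. -/
theorem bAB' (hI : AntiprismIso b σ) (i j : Fin 6) (h : j = i + 1) : b (σ (apA j)) (σ (apB i)) :=
  hI.bond (apAB_diag i j h).1 (apAB_diag i j h).2

/-- Labels of different rings are different vertices. -/
theorem neAB (σ : Equiv.Perm (Fin 12)) (i j : Fin 6) : σ (apA i) ≠ σ (apB j) :=
  fun h => apA_ne_apB i j (σ.injective h)

end AntiprismIso

/-! ## §2 The normalised code of a scale-free dozen: far pairs, corner window, mirror -/

namespace IsScaleFreeDozen

variable {t : Fin 12 → E3} {b : Fin 12 → Fin 12 → Prop}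

/-- The bond window of two bonded directions. -/
theorem window (hD : IsScaleFreeDozen t b) {k l : Fin 12} (hb : b k l) :
    2201 / 4802 ≤ ⟪‖t k‖⁻¹ • t k, ‖t l‖⁻¹ • t l⟫ ∧ ⟪‖t k‖⁻¹ • t k, ‖t l‖⁻¹ • t l⟫ ≤ 2801 / 5202 :=
  ⟨hD.le_inner_normalize hb, hD.inner_normalize_le (hD.ne_of_bond hb)⟩

/-- **Far pairs** (part ZD over a dozen): along a bond chain `p – q – r – s` about `v` with `p ≠ r`, `q ≠ s`,
`⟪û p, û s⟫ ≤ 1233/5202`. -/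
theorem inner_normalize_far (hD : IsScaleFreeDozen t b) {v p q r s : Fin 12} (hvp : b v p) (hvq : b v q)
    (hvr : b v r) (hvs : b v s) (hpq : b p q) (hqr : b q r) (hrs : b r s) (hpr : p ≠ r) (hqs : q ≠ s) :
    ⟪‖t p‖⁻¹ • t p, ‖t s‖⁻¹ • t s⟫ ≤ 1233 / 5202 :=
  inner_le_far_of_chain (hD.norm_normalize v) (hD.norm_normalize p) (hD.norm_normalize q) (hD.norm_normalize r)
    (hD.norm_normalize s) (hD.window hvp) (hD.window hvq) (hD.window hvr) (hD.window hvs) (hD.window hpq)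
    (hD.window hqr) (hD.window hrs) (hD.inner_normalize_le hpr) (hD.inner_normalize_le hqs)

/-- **Corner window of the normalised code** (part ZE, transported by `angle_perpTo_nrm`). -/
theorem tCorner_window_normalize (hD : IsScaleFreeDozen t b) {v a c : Fin 12} (hva : b v a) (hvc : b v c)
    (hac : b a c) :
    Real.arccos (81 / 200) ≤ InnerProductGeometry.angle (perpTo (‖t v‖⁻¹ • t v) (‖t a‖⁻¹ • t a))
        (perpTo (‖t v‖⁻¹ • t v) (‖t c‖⁻¹ • t c)) ∧
      InnerProductGeometry.angle (perpTo (‖t v‖⁻¹ • t v) (‖t a‖⁻¹ • t a))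
        (perpTo (‖t v‖⁻¹ • t v) (‖t c‖⁻¹ • t c)) ≤ Real.arccos (1 / 4) := by
  rw [AntiprismShell.angle_perpTo_nrm (hD.norm_pos v) (hD.norm_pos a) (hD.norm_pos c)]
  exact hD.tCorner_window hva hvc hac

/-- **Mirror invariance**: `−t` is a scale-free dozen with the same bonds. -/
theorem neg (hD : IsScaleFreeDozen t b) : IsScaleFreeDozen (fun k => -t k) b := by
  obtain ⟨h1, h2, h3, h4, h5, h6, h7⟩ := hD
  refine ⟨?_, ?_, h3, h4, h5, ?_, ?_⟩
  · simpa only [norm_neg] using h1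
  · simpa only [norm_neg, dist_neg_neg] using h2
  · simpa only [norm_neg, dist_neg_neg] using h6
  · simpa only [norm_neg, dist_neg_neg] using h7

/-! ## §3 The antiprism budget applied -/

/-- **Core**: a scale-free dozen with the antiprism bond graph and `(A₀, A₁, B₀)` positively oriented is impossible. -/
theorem noAntiprism_core (hD : IsScaleFreeDozen t b) {σ : Equiv.Perm (Fin 12)} (hI : AntiprismIso b σ)
    (hpos : 0 < orient3 (‖t (σ (apA 0))‖⁻¹ • t (σ (apA 0))) (‖t (σ (apA 1))‖⁻¹ • t (σ (apA 1)))
      (‖t (σ (apB 0))‖⁻¹ • t (σ (apB 0)))) : False := by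
  refine AntiprismShell.no_config (fun i => ‖t (σ (apA i))‖⁻¹ • t (σ (apA i)))
    (fun i => ‖t (σ (apB i))‖⁻¹ • t (σ (apB i))) (fun i => hD.norm_normalize _) (fun i => hD.norm_normalize _)
    (fun i j h => hD.window (hI.bAA i j h)) (fun i j h => hD.window (hI.bBB i j h)) (fun i => hD.window (hI.bAB i))
    (fun i j h => hD.window (hI.bAB' i j h)) ?_ ?_
    (fun i j h => hD.tCorner_window_normalize (hI.bAA i j h) (hI.bAB i) (hI.bAB' i j h))
    (fun i j h => hD.tCorner_window_normalize (hI.bAB j) (hI.bAB' i j h) (hD.symm (hI.bBB i j h)))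
    (fun i j h => hD.tCorner_window_normalize (hI.bAB' i j h) (hD.symm (hI.bAA i j h)) (hD.symm (hI.bAB i)))
    (fun i j h => hD.tCorner_window_normalize (hD.symm (hI.bBB i j h)) (hD.symm (hI.bAB j))
      (hD.symm (hI.bAB' i j h)))
    (fun i j h => hD.tCorner_window_normalize (hD.symm (hI.bAB i)) (hD.symm (hI.bAB' i j h)) (hI.bAA i j h))
    (fun i j h => hD.tCorner_window_normalize (hD.symm (hI.bAB' i j h)) (hI.bBB i j h) (hI.bAB j)) hpos
  · -- far pairs on ring `A`: the chain `A_j – B_{i+1} – B_i – A_i` about `A_{i+1}`, `j = i + 2`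
    intro i j h
    have e2 : (2 : Fin 6) = 1 + 1 := by decide
    have h2 : j = i + 1 + 1 := by rw [h, add_assoc, e2]
    exact hD.inner_normalize_far (hI.bAA (i + 1) j h2) (hI.bAB (i + 1)) (hI.bAB' i (i + 1) rfl)
      (hD.symm (hI.bAA i (i + 1) rfl)) (hI.bAB' (i + 1) j h2) (hD.symm (hI.bBB i (i + 1) rfl))
      (hD.symm (hI.bAB i)) (AntiprismIso.neAB σ j i) (AntiprismIso.neAB σ i (i + 1)).symm
  · -- far pairs on ring `B`: the chain `B_j – A_j – A_{i+1} – B_i` about `B_{i+1}`, `j = i + 2`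
    intro i j h
    have e2 : (2 : Fin 6) = 1 + 1 := by decide
    have h2 : j = i + 1 + 1 := by rw [h, add_assoc, e2]
    exact hD.inner_normalize_far (hI.bBB (i + 1) j h2) (hD.symm (hI.bAB' (i + 1) j h2))
      (hD.symm (hI.bAB (i + 1))) (hD.symm (hI.bBB i (i + 1) rfl)) (hD.symm (hI.bAB j))
      (hD.symm (hI.bAA (i + 1) j h2)) (hI.bAB' i (i + 1) rfl) (AntiprismIso.neAB σ (i + 1) j).symm
      (AntiprismIso.neAB σ j i)

end IsScaleFreeDozen

/-- ★★ **[A] NO ANTIPRISM**: no scale-free dozen has the hexagonal-antiprism bond graph. -/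
theorem noAntiprismDozen_holds : NoAntiprismDozen := by
  intro t b hD σ hI
  rcases lt_trichotomy 0 (orient3 (‖t (σ (apA 0))‖⁻¹ • t (σ (apA 0))) (‖t (σ (apA 1))‖⁻¹ • t (σ (apA 1)))
      (‖t (σ (apB 0))‖⁻¹ • t (σ (apB 0)))) with h | h | h
  · exact hD.noAntiprism_core hI h
  · -- degenerate orientation: the corner at `A₀` is a genuine turn
    have b01 : b (σ (apA 0)) (σ (apA 1)) := hI.bAA 0 1 (by decide)
    have b06 : b (σ (apA 0)) (σ (apB 0)) := hI.bAB 0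
    have b16 : b (σ (apA 1)) (σ (apB 0)) := hI.bAB' 0 1 (by decide)
    have hw := hD.tCorner_window_normalize b01 b06 b16
    obtain ⟨hTm, hTM, -⟩ := AntiprismShell.T_bounds
    refine AntiprismShell.orient3_ne_zero_of_angle (hD.norm_normalize _)
      (AntiprismShell.perpTo_ne_zero_of_unit (hD.norm_normalize _) (hD.norm_normalize _)
        (AntiprismShell.sq_lt_one_of_window (hD.window b01)))
      (AntiprismShell.perpTo_ne_zero_of_unit (hD.norm_normalize _) (hD.norm_normalize _)
        (AntiprismShell.sq_lt_one_of_window (hD.window b06)))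
      (by linarith [hw.1, Real.pi_pos]) (by linarith [hw.2, Real.pi_pos]) h.symm
  · -- negative orientation: pass to the mirror image
    have e : ∀ k : Fin 12, ‖-t k‖⁻¹ • (-t k) = -(‖t k‖⁻¹ • t k) := fun k => by rw [norm_neg, smul_neg]
    refine hD.neg.noAntiprism_core hI ?_
    show 0 < orient3 (‖-t (σ (apA 0))‖⁻¹ • (-t (σ (apA 0)))) (‖-t (σ (apA 1))‖⁻¹ • (-t (σ (apA 1))))
      (‖-t (σ (apB 0))‖⁻¹ • (-t (σ (apB 0))))
    rw [e, e, e, AntiprismShell.orient3_neg_neg_neg]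
    linarith

end Summit.AtomisticToContinuum.Crystallization.Theorems.ChargedEnergyGapChartDial

end
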